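import Summits.FinalStateConjecture.FinalStateConjecture.Theses.RecedingSphereBudgets
import Summits.FinalStateConjecture.FinalStateConjecture.Theorems.RecedingSphereBudgetsAlmostMonotoneLimit
import HarnessLib

/-!
# Birth skeleton — crux stmt-FinalStateConjecture-17686 `Theses.RecedingSphereBudgets.MassFreezing` (M, rank 2)
# line `birth` (skeleton registrar planner-skel-stmt-FinalStateConjecture-17686-0, 2026-08-17; BC3 of run/shared/lean/lens3/_common/BC.md)

M (MASS FREEZING): for every admissible datum, every MGHD with complete `𝓘⁺` and every shape-settled final era
with drifting labels `Q′` (the route's rev-14 hypothesis block: `N` hole charts on collar domains of ADIABATIC boosted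
Kerr–Schild backgrounds with smooth drifting labels `(Mᵢ(τ), aᵢ(τ))` in a compact sub-extremal box, all derivatives
`→ 0`; fixed pairwise distinct future-directed motions `(Λᵢ, cᵢ)`; one flat late chart `Ψ₀` on `U₀` with wave-zone
weights and finite slab energy; covering, separation, rays, orientation, honest radii), EACH MASS LABEL CONVERGES:
`∀ i, ∃ Mᵢ∞, Mᵢ(τ) → Mᵢ∞`.

The cut is the route's own foreseen split of M (card K1 + K2, "every hole has its own Bondi mass") plus the one
missing normalisation named by the route review (refuter rreview1, evidence `KLayerGlue.lean` on this item,
2026-08-16: `K1 → K2 → AlmostMonotoneLimit → MassFreezing-under-W` closes sorry-free, so the split closes modulo a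
WAVE REGAUGING of the flat chart only):

* `stub_recedingEnergyAlmostMonotone` = the route crux `RecedingEnergyAlmostMonotone` (stmt-FinalStateConjecture-17688,
  K1) BY NAME: under `Q′` AND the wave-coordinate clause W (`Σ_μ ∂_μ 𝔤^{μν}(η + h) = 0` on the late flat region) the
  Landau–Lifshitz energy `Eᵢ(t) = P⁰(t, ξᵢ(t), βt)` of the receding coordinate sphere around hole `i` (admissible
  speed `β`: `0 < β`, `‖vᵢ‖ + β < 1`, `2β < ‖vᵢ − vⱼ‖`) is bounded below and almost non-increasing with an error
  `F → 0`.  Why it might fail: the LL energy of a sphere of area `∼ t²` is a priori `O(t)`; no clause of `Q′` makes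
  the influx through the sphere `L¹` (route docstring).  Stated by name because its verbatim text (3958 chars)
  exceeds the stub-signature cap; proving the route item proves the stub.
* `stub_recedingEnergyIdentification` = the route crux `RecedingEnergyIdentification` (stmt-FinalStateConjecture-17689,
  K2) BY NAME: under `Q′ ∧ W`, `Eᵢ(t) − eᵢ⁰ · Mᵢ((t − cᵢ⁰)/eᵢ⁰) → 0` (the sphere energy IS the boosted mass label read
  on the hole's clock).  Why it might fail: residual gauge/tail amplitudes under the `(1+d)^{9/10}` weight; the
  label ↔ sphere bridge crosses the uncertified gap between the collar chart and the flat chart (route docstring).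
* `stub_waveRegauging` (RG, NEW, typed here def-free): under `Q′` the FLAT chart can be replaced by a harmonic one:
  there are `(τ₀', ρ', U₀', Ψ₀', O')` — hole charts, labels and motions untouched — satisfying `Q′` again together
  with W.  This is the "missing normalisation" of the K2 repair (refuters rattack-13657-0 and rattack-13657-g2-0: pure-gauge
  deformations of `Ψ₀` preserving `Q′` shift the sphere energy at `O(1)`; all violate W).  Why it might fail:
  asymptotic wave coordinates exist near `𝓘⁺`/`i⁺` for small data (Lindblad–Rodnianski 2010, Thm. 1.1; Hintz–Vasy
  arXiv:1711.00195) but here the far region surrounds `N` receding holes: the harmonic map must be solved on the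
  late exterior with boundary data on the excision tubes, and the weak-null `log` losses of wave coordinates
  (`h_{LL} ∼ t⁻¹ log t`) must still fit under the `(1+d)^{9/10}|h| ≤ C`, `(1+d)|D^{1,2}h| ≤ C` weights and the
  slab-energy bound of `Q′`; the covering/rays/orientation clauses must be re-certified for the new `O'`.
  Sources: LindbladRodnianski2010Annals (Thm. 1.1: global wave-coordinate gauge for small data), arXiv:1711.00195,
  ChoquetBruhat2009 (wave gauge), LandauLifshitz1975 §96, doi:10.1007/s00220-002-0723-2.  Size: L/XL.

Composition `MassFreezing_of : RecedingEnergyAlmostMonotone → RecedingEnergyIdentification → Sig.stub_waveRegauging →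
MassFreezing` is a REAL proof (no `sorry`): regauge the flat chart by RG; the chart 4-velocities `eᵢ = Λᵢ e₀` are
unit timelike (`η(eᵢ,eᵢ) = −1`, Lorentz invariance) and future-directed (`Q′`), so the 3-velocities
`vᵢ = e̲ᵢ/eᵢ⁰` have `‖vᵢ‖ < 1` and are pairwise distinct (`e` injective by `Q′`; `v` determines `e`), whence an
admissible speed `β` exists (finitely many strict inequalities, `𝓝[>] 0`); K1 + the landed support item
`AlmostMonotoneLimit` (`Theorems.almostMonotoneLimit_proof`) give `Eᵢ → l`; K2 and the inversion of the affine hole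
clock `t ↦ (t − cᵢ⁰)/eᵢ⁰` give `Mᵢ → l/eᵢ⁰`.  `massFreezing_of_stubs : MassFreezing` = the crux BY NAME modulo the
three stubs.
Disproof.lean: none exists for this crux (`ledger crux ls stmt-FinalStateConjecture-17686`: no workfiles at
registration) — no `_false_without_` obligations to honour.  Negatives index (`ledger negatives --problem
FinalStateConjecture`, 1 entry: `not_UniformPhotonSphereChannels`, an ODE channel estimate): unrelated to every stub.
BC3 probes (folder `bc/MassFreezing_probes.lean`, `bc/MassFreezing_probes_RG.lean`, `maxHeartbeats 400000`): for each
stub S ∈ {K1, K2, RG}, `S → MassFreezing` and `S → FinalStateConjecture` by `first | exact? | simpa | aesop` FAIL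
(K1/K2: `exact?`/`simpa` fail, aesop "failed to prove the goal after exhaustive search"; RG: `exact?` "could not
close the goal", `simpa` "assumption failed", aesop exhaustive-search failure; the combined `simpa [RG]` variant only
times out at `whnf`), and the converses `MassFreezing → S` fail likewise: no stub is cheaply the crux or the summit.
-/

set_option linter.dupNamespace false
set_option linter.unusedVariables false

noncomputable section

open scoped BigOperators Topology Manifold ContDiff Classical MeasureTheory ENNReal Matrix InnerProductSpace
open Filter Set Function TopologicalSpace MeasureTheory Literature.Geometry.Lorentzian

namespace Summit.FinalStateConjecture.FinalStateConjecture.Cruxes.MassFreezing.Birth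

open Summit.FinalStateConjecture.FinalStateConjecture.Theses.RecedingSphereBudgets
  (MassFreezing RecedingEnergyAlmostMonotone RecedingEnergyIdentification AlmostMonotoneLimit)

/-! ## Legend: the regauging stub as a named proposition (verbatim the registered signature) -/

/-- Statement of `stub_waveRegauging` (RG): under `Q′` (the hypothesis block of `MassFreezing`, abstracted over the
flat data `(τ₀, ρ, U₀, Ψ₀, O)` as the local `Q`) there is flat data satisfying `Q′` again together with the
wave-coordinate clause W (the local `W`, verbatim the clause of K1/K2). -/
def Sig.stub_waveRegauging : Prop :=
  open Literature.Geometry.Lorentzian Summit.FinalStateConjecture LandauLifshitz in ∀ (X : Type) [TopologicalSpace X] [ChartedSpace E3 X] [IsManifold (𝓡 3) (⊤ : ℕ∞) X] [T2Space X] [SecondCountableTopology X] [ConnectedSpace X], ∀ D ∈ admissibleVacuumData X, ∀ 𝒟 : VacuumCauchyDevelopment D, 𝒟.IsMaximal → HasCompleteNullInfinity 𝒟.toCauchyDevelopment → ∀ (N : ℕ) (m₀ χ δ₀ : ℝ) (M a : Fin N → ℝ → ℝ) (motion : Fin N → lorentzGroup × E4) (U : Fin N → Opens E4) (Ψ : ∀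 i, U i → 𝒟.carrier), (let S := 𝒟.toSpacetime; let 𝒞 := 𝒟.toCauchyDevelopment; let J := 𝒟.metric.causalPast 𝒟.timeOrientation; let L := fun i ↦ ((motion i).1 : E4 ≃L[ℝ] E4); let p := fun i ↦ poincareInv (motion i).1 (motion i).2; let e := fun i ↦ L i (E4.basisVector 0); let B : Fin N → ModelBackground := fun i ↦ ⟨U i, fun x ↦ boostedKerrBilin (motion i).1 (motion i).2 (M i (p i x 0)) (a i (p i x 0)) x, fun x ↦ p i x 0, fun x ↦ Kerr.radius (a i (p i x 0)) (p i x)⟩; let ξ := fun i (t : ℝ) ↦ E4.spatial (((t - (motion i).2 0) / e i 0) • e i + (motion i).2); let Q := fun (τ₀ : ℝ) (ρ : Fin N → ℝ → ℝ) (U₀ : Opens E4) (Ψ₀ : U₀ → 𝒟.carrier) (O : Set 𝒟.carrier) ↦ (let B₀ := Minkowski.backgroundOn U₀; let h := S.deviationExtend B₀ Ψ₀; let ext := fun i ↦ (B i).lateRegion τ₀ ∩ {x | Kerr.rPlus (M i (p i x.1 0)) (a i (p i x.1 0)) < (B i).radius x.1}; (0 < m₀ ∧ 0 ≤ χ ∧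 χ < 1 ∧ 0 < δ₀ ∧ 2 * δ₀ < m₀) ∧ (∀ i, ContDiff ℝ (⊤ : ℕ∞) (M i) ∧ ContDiff ℝ (⊤ : ℕ∞) (a i) ∧ (∀ t, m₀ ≤ M i t ∧ M i t ≤ m₀⁻¹ ∧ |a i t| ≤ χ * M i t) ∧ ∀ n : ℕ, 1 ≤ n → Tendsto (iteratedDeriv n (M i)) atTop (𝓝 0) ∧ Tendsto (iteratedDeriv n (a i)) atTop (𝓝 0)) ∧ (∀ i, 0 < e i 0) ∧ Function.Injective e ∧ (∀ i, (U i : Set E4) = p i ⁻¹' {y : E4 | Kerr.rPlus (M i (y 0)) (a i (y 0)) - δ₀ < Kerr.radius (a i (y 0)) y}) ∧ (∀ i, S.IsLateChart (B i) Set.univ τ₀ (Ψ i) ∧ Ψ i '' ext i ⊆ O) ∧ (∀ i (k : ℕ) (R : ℝ), Tendsto (S.truncDeviationCk (B i) (Ψ i) k R) atTop (𝓝 0)) ∧ (∀ R : ℝ, ∃ τ₁, Pairwise (Disjoint on fun i ↦ Ψ i '' (B i).truncLateRegion τ₁ R)) ∧ (∀ i, Tendsto (fun t ↦ ρ i t /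 t) atTop (𝓝 0)) ∧ {x : E4 | τ₀ < x 0 ∧ ∀ i, ρ i (x 0) < E4.spatialNorm (p i x)} ⊆ ↑U₀ ∧ S.IsLateChart B₀ O τ₀ Ψ₀ ∧ Tendsto (S.deviationCk B₀ Ψ₀ 2) atTop (𝓝 0) ∧ O = exteriorOf 𝒞 (Ψ₀ '' B₀.lateRegion τ₀ ∪ ⋃ i, Ψ i '' ext i) ∧ (∀ τ₁ ≥ τ₀, RaysStayInClosure 𝒞 (exteriorOf 𝒞 (Ψ₀ '' B₀.lateRegion τ₁))) ∧ (∀ i (ϱ : ℝ), ∀ᶠ τ in atTop, ∀ x ∈ (B i).truncTimeSlab ϱ τ, 𝒟.timeOrientation.IsFutureDirected (mfderiv 𝓘(ℝ, E4) (𝓡 4) (Ψ i) x (L i (Kerr.timeVector (M i (p i x.1 0)) (a i (p i x.1 0)) (p i x.1))))) ∧ (∀ᶠ τ in atTop, ∀ x ∈ B₀.timeSlab τ, 𝒟.timeOrientation.IsFutureDirected (mfderiv 𝓘(ℝ, E4) (𝓡 4) Ψ₀ x (E4.basisVector 0))) ∧ O \ ((⋃ i, Ψ i '' (B i).lateRegion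 τ₀) ∪ Ψ₀ '' B₀.lateRegion τ₀) ⊆ J ((⋃ i, Ψ i '' (B i).timeSlab τ₀) ∪ Ψ₀ '' B₀.timeSlab τ₀) ∧ (∃ C₁ C₂ : ℝ, ∀ i (x : U i) (y : U₀), τ₀ < (B i).time x.1 → Ψ i x = Ψ₀ y → ‖E4.spatial y.1 - ξ i (y.1 0)‖ ≤ C₂ * (B i).radius x.1 + C₁) ∧ (∃ C_W : ℝ, ∀ᶠ τ in atTop, ∀ x : U₀, x.1 0 = τ → let w := 1 + ⨅ i, ‖E4.spatial x.1 - ξ i τ‖; w ^ (9 / 10 : ℝ) * ‖h x.1‖ ≤ C_W ∧ ∀ m : ℕ, 1 ≤ m → m ≤ 2 → w * ‖iteratedFDeriv ℝ m h x.1‖ ≤ C_W) ∧ (∃ C_E : ℝ, ∀ᶠ τ in atTop, ∫⁻ y in {y : E3 | E4.ofTimeSpace τ y ∈ U₀}, ‖iteratedFDeriv ℝ 1 h (E4.ofTimeSpace τ y)‖ₑ ^ 2 ≤ ENNReal.ofReal C_E) ∧ ∃ R : Fin N → ℝ → ℝ, (∀ i, Tendsto (fun τ ↦ S.truncDeviationCk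 (B i) (Ψ i) 2 (R i τ) τ) atTop (𝓝 0)) ∧ ∀ τ₁ > τ₀, O \ (Ψ₀ '' B₀.lateRegion τ₁ ∪ ⋃ i, Ψ i '' {x | τ₁ < (B i).time x.1 ∧ (B i).radius x.1 ≤ R i ((B i).time x.1)}) ⊆ J (Ψ₀ '' B₀.timeSlab τ₁ ∪ ⋃ i, Ψ i '' (B i).truncTimeSlab (R i τ₁) τ₁)); let W := fun (τ₀ : ℝ) (U₀ : Opens E4) (Ψ₀ : U₀ → 𝒟.carrier) ↦ (let h := S.deviationExtend (Minkowski.backgroundOn U₀) Ψ₀; ∀ x : U₀, τ₀ < x.1 0 → ∀ ν : Fin 4, ∑ μ : Fin 4, partialDeriv μ (fun y ↦ gothic (fun z ↦ Minkowski.bilin + h z) y μ ν) x.1 = 0); (∃ τ₀ ρ U₀ Ψ₀ O, Q τ₀ ρ U₀ Ψ₀ O) → ∃ τ₀ ρ U₀ Ψ₀ O, Q τ₀ ρ U₀ Ψ₀ O ∧ W τ₀ U₀ Ψ₀)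

/-! ## The three registered stubs -/

/-- **K1 — RECEDING ENERGY ALMOST MONOTONE** = route crux `RecedingEnergyAlmostMonotone`
(stmt-FinalStateConjecture-17688), by name. -/
theorem stub_recedingEnergyAlmostMonotone :
    Summit.FinalStateConjecture.FinalStateConjecture.Theses.RecedingSphereBudgets.RecedingEnergyAlmostMonotone := by
  sorry

/-- **K2 — RECEDING ENERGY IDENTIFICATION** = route crux `RecedingEnergyIdentification`
(stmt-FinalStateConjecture-17689), by name. -/
theorem stub_recedingEnergyIdentification :
    Summit.FinalStateConjecture.FinalStateConjecture.Theses.RecedingSphereBudgets.RecedingEnergyIdentification := by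
  sorry

/-- **RG — WAVE REGAUGING OF THE FLAT CHART** (new; see the module docstring for the informal statement, why it
might fail, sources). -/
theorem stub_waveRegauging : open Literature.Geometry.Lorentzian Summit.FinalStateConjecture LandauLifshitz in ∀ (X : Type) [TopologicalSpace X] [ChartedSpace E3 X] [IsManifold (𝓡 3) (⊤ : ℕ∞) X] [T2Space X] [SecondCountableTopology X] [ConnectedSpace X], ∀ D ∈ admissibleVacuumData X, ∀ 𝒟 : VacuumCauchyDevelopment D, 𝒟.IsMaximal → HasCompleteNullInfinity 𝒟.toCauchyDevelopment → ∀ (N : ℕ) (m₀ χ δ₀ : ℝ) (M a : Fin N → ℝ → ℝ) (motion : Fin N → lorentzGroup × E4) (U : Fin N → Opens E4) (Ψ : ∀ i, U i → 𝒟.carrier), (let S := 𝒟.toSpacetime; let 𝒞 := 𝒟.toCauchyDevelopment; let J := 𝒟.metric.causalPast 𝒟.timeOrientation; let L := fun i ↦ ((motion i).1 : E4 ≃L[ℝ] E4); let p := fun i ↦ poincareInv (motion i).1 (motion i).2; let e := fun i ↦ L i (E4.basisVector 0); let B : Fin N → ModelBackground := fun i ↦ ⟨U i, fun x ↦ boostedKerrBilin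 (motion i).1 (motion i).2 (M i (p i x 0)) (a i (p i x 0)) x, fun x ↦ p i x 0, fun x ↦ Kerr.radius (a i (p i x 0)) (p i x)⟩; let ξ := fun i (t : ℝ) ↦ E4.spatial (((t - (motion i).2 0) / e i 0) • e i + (motion i).2); let Q := fun (τ₀ : ℝ) (ρ : Fin N → ℝ → ℝ) (U₀ : Opens E4) (Ψ₀ : U₀ → 𝒟.carrier) (O : Set 𝒟.carrier) ↦ (let B₀ := Minkowski.backgroundOn U₀; let h := S.deviationExtend B₀ Ψ₀; let ext := fun i ↦ (B i).lateRegion τ₀ ∩ {x | Kerr.rPlus (M i (p i x.1 0)) (a i (p i x.1 0)) < (B i).radius x.1}; (0 < m₀ ∧ 0 ≤ χ ∧ χ < 1 ∧ 0 < δ₀ ∧ 2 * δ₀ < m₀) ∧ (∀ i, ContDiff ℝ (⊤ : ℕ∞) (M i) ∧ ContDiff ℝ (⊤ : ℕ∞) (a i) ∧ (∀ t, m₀ ≤ M i t ∧ M i t ≤ m₀⁻¹ ∧ |a i t| ≤ χ * M i t) ∧ ∀ n : ℕ, 1 ≤ n → Tendsto (iteratedDeriv n (M i)) atTop (𝓝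 0) ∧ Tendsto (iteratedDeriv n (a i)) atTop (𝓝 0)) ∧ (∀ i, 0 < e i 0) ∧ Function.Injective e ∧ (∀ i, (U i : Set E4) = p i ⁻¹' {y : E4 | Kerr.rPlus (M i (y 0)) (a i (y 0)) - δ₀ < Kerr.radius (a i (y 0)) y}) ∧ (∀ i, S.IsLateChart (B i) Set.univ τ₀ (Ψ i) ∧ Ψ i '' ext i ⊆ O) ∧ (∀ i (k : ℕ) (R : ℝ), Tendsto (S.truncDeviationCk (B i) (Ψ i) k R) atTop (𝓝 0)) ∧ (∀ R : ℝ, ∃ τ₁, Pairwise (Disjoint on fun i ↦ Ψ i '' (B i).truncLateRegion τ₁ R)) ∧ (∀ i, Tendsto (fun t ↦ ρ i t / t) atTop (𝓝 0)) ∧ {x : E4 | τ₀ < x 0 ∧ ∀ i, ρ i (x 0) < E4.spatialNorm (p i x)} ⊆ ↑U₀ ∧ S.IsLateChart B₀ O τ₀ Ψ₀ ∧ Tendsto (S.deviationCk B₀ Ψ₀ 2) atTop (𝓝 0) ∧ O = exteriorOf 𝒞 (Ψ₀ '' B₀.lateRegion τ₀ ∪ ⋃ i, Ψ i '' ext i)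 ∧ (∀ τ₁ ≥ τ₀, RaysStayInClosure 𝒞 (exteriorOf 𝒞 (Ψ₀ '' B₀.lateRegion τ₁))) ∧ (∀ i (ϱ : ℝ), ∀ᶠ τ in atTop, ∀ x ∈ (B i).truncTimeSlab ϱ τ, 𝒟.timeOrientation.IsFutureDirected (mfderiv 𝓘(ℝ, E4) (𝓡 4) (Ψ i) x (L i (Kerr.timeVector (M i (p i x.1 0)) (a i (p i x.1 0)) (p i x.1))))) ∧ (∀ᶠ τ in atTop, ∀ x ∈ B₀.timeSlab τ, 𝒟.timeOrientation.IsFutureDirected (mfderiv 𝓘(ℝ, E4) (𝓡 4) Ψ₀ x (E4.basisVector 0))) ∧ O \ ((⋃ i, Ψ i '' (B i).lateRegion τ₀) ∪ Ψ₀ '' B₀.lateRegion τ₀) ⊆ J ((⋃ i, Ψ i '' (B i).timeSlab τ₀) ∪ Ψ₀ '' B₀.timeSlab τ₀) ∧ (∃ C₁ C₂ : ℝ, ∀ i (x : U i) (y : U₀), τ₀ < (B i).time x.1 → Ψ i x = Ψ₀ y → ‖E4.spatial y.1 - ξ i (y.1 0)‖ ≤ C₂ * (B i).radius x.1 + C₁)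 ∧ (∃ C_W : ℝ, ∀ᶠ τ in atTop, ∀ x : U₀, x.1 0 = τ → let w := 1 + ⨅ i, ‖E4.spatial x.1 - ξ i τ‖; w ^ (9 / 10 : ℝ) * ‖h x.1‖ ≤ C_W ∧ ∀ m : ℕ, 1 ≤ m → m ≤ 2 → w * ‖iteratedFDeriv ℝ m h x.1‖ ≤ C_W) ∧ (∃ C_E : ℝ, ∀ᶠ τ in atTop, ∫⁻ y in {y : E3 | E4.ofTimeSpace τ y ∈ U₀}, ‖iteratedFDeriv ℝ 1 h (E4.ofTimeSpace τ y)‖ₑ ^ 2 ≤ ENNReal.ofReal C_E) ∧ ∃ R : Fin N → ℝ → ℝ, (∀ i, Tendsto (fun τ ↦ S.truncDeviationCk (B i) (Ψ i) 2 (R i τ) τ) atTop (𝓝 0)) ∧ ∀ τ₁ > τ₀, O \ (Ψ₀ '' B₀.lateRegion τ₁ ∪ ⋃ i, Ψ i '' {x | τ₁ < (B i).time x.1 ∧ (B i).radius x.1 ≤ R i ((B i).time x.1)}) ⊆ J (Ψ₀ '' B₀.timeSlab τ₁ ∪ ⋃ i, Ψ i '' (B i).truncTimeSlab (R i τ₁)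 τ₁)); let W := fun (τ₀ : ℝ) (U₀ : Opens E4) (Ψ₀ : U₀ → 𝒟.carrier) ↦ (let h := S.deviationExtend (Minkowski.backgroundOn U₀) Ψ₀; ∀ x : U₀, τ₀ < x.1 0 → ∀ ν : Fin 4, ∑ μ : Fin 4, partialDeriv μ (fun y ↦ gothic (fun z ↦ Minkowski.bilin + h z) y μ ν) x.1 = 0); (∃ τ₀ ρ U₀ Ψ₀ O, Q τ₀ ρ U₀ Ψ₀ O) → ∃ τ₀ ρ U₀ Ψ₀ O, Q τ₀ ρ U₀ Ψ₀ O ∧ W τ₀ U₀ Ψ₀) := by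
  sorry

/-! ## Glue lemmas (proved): hyperbolic kinematics of the chart 4-velocities and the hole clock -/

/-- A Lorentz transformation maps `e₀ = ∂ₜ` to a unit timelike vector: `η(Λe₀, Λe₀) = −1`. -/
theorem bilin_fourVelocity (Λ : lorentzGroup) :
    Minkowski.bilin ((Λ : E4 ≃L[ℝ] E4) (E4.basisVector 0)) ((Λ : E4 ≃L[ℝ] E4) (E4.basisVector 0)) = -1 :=
  (Λ.2 _ _).trans Minkowski.bilin_basisVector_zero

/-- For a unit timelike `e`, `‖e̲‖² = (e⁰)² − 1`. -/
theorem norm_spatial_sq {e : E4} (he : Minkowski.bilin e e = -1) :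
    ‖E4.spatial e‖ ^ 2 = e 0 ^ 2 - 1 := by
  have h1 : ‖E4.spatial e‖ ^ 2 = ∑ i : Fin 3, (e i.succ) ^ 2 := by
    rw [EuclideanSpace.norm_sq_eq]
    simp [E4.spatial_apply, sq_abs]
  have h2 : ∑ i : Fin 3, (e i.succ) ^ 2 = ∑ i : Fin 3, e i.succ * e i.succ :=
    Finset.sum_congr rfl fun i _ ↦ sq (e i.succ)
  simp only [Minkowski.bilin_apply] at he
  rw [h1, h2]
  linarith

/-- A future-directed unit timelike 4-velocity has 3-speed `‖e̲/e⁰‖ < 1`. -/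
theorem speed_lt_one {e : E4} (he : Minkowski.bilin e e = -1) (he0 : 0 < e 0) :
    ‖(e 0)⁻¹ • E4.spatial e‖ < 1 := by
  have hsq := norm_spatial_sq he
  have hlt : ‖E4.spatial e‖ < e 0 := by
    nlinarith [norm_nonneg (E4.spatial e), hsq, he0]
  rw [norm_smul, norm_inv, Real.norm_eq_abs, abs_of_pos he0]
  rw [inv_mul_lt_iff₀ he0]
  simpa using hlt

/-- The 3-velocity determines the future-directed unit 4-velocity. -/
theorem eq_of_velocity_eq {e e' : E4} (he : Minkowski.bilin e e = -1) (he' : Minkowski.bilin e' e' = -1)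
    (h0 : 0 < e 0) (h0' : 0 < e' 0)
    (hv : (e 0)⁻¹ • E4.spatial e = (e' 0)⁻¹ • E4.spatial e') : e = e' := by
  have hsq := norm_spatial_sq he
  have hsq' := norm_spatial_sq he'
  have hn : ∀ {f : E4}, Minkowski.bilin f f = -1 → 0 < f 0 →
      ‖(f 0)⁻¹ • E4.spatial f‖ ^ 2 = 1 - (f 0 ^ 2)⁻¹ := by
    intro f hf hf0
    have hf0' : f 0 ^ 2 ≠ 0 := pow_ne_zero 2 hf0.ne'
    rw [norm_smul, mul_pow, norm_inv, Real.norm_eq_abs, inv_pow, sq_abs, norm_spatial_sq hf, inv_mul_eq_div,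
      sub_div, div_self hf0', one_div]
  have h00 : e 0 = e' 0 := by
    have h := congrArg (fun w : E3 ↦ ‖w‖ ^ 2) hv
    simp only at h
    rw [hn he h0, hn he' h0'] at h
    have hsq2 : e 0 ^ 2 = e' 0 ^ 2 := by
      have : (e 0 ^ 2)⁻¹ = (e' 0 ^ 2)⁻¹ := by linarith
      exact inv_inj.mp this
    nlinarith [hsq2, h0, h0']
  have hsp : E4.spatial e = E4.spatial e' := by
    rw [h00] at hv
    exact (smul_right_inj (inv_ne_zero h0'.ne')).mp hv
  rw [← E4.ofTimeSpace_time_spatial e, ← E4.ofTimeSpace_time_spatial e', E4.time_apply, E4.time_apply, h00, hsp]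

/-- ADMISSIBLE SPEEDS EXIST: finitely many pairwise distinct sub-luminal 3-velocities leave room for a speed `β`
with `‖vᵢ‖ + β < 1` and `2β < ‖vᵢ − vⱼ‖` for all `j ≠ i`. -/
theorem exists_admissible_speed {N : ℕ} (v : Fin N → E3) (i : Fin N) (hvi : ‖v i‖ < 1)
    (hne : ∀ j, j ≠ i → v i ≠ v j) :
    ∃ β : ℝ, 0 < β ∧ ‖v i‖ + β < 1 ∧ ∀ j, j ≠ i → 2 * β < ‖v i - v j‖ := by
  have h1 : ∀ᶠ β in 𝓝[>] (0 : ℝ), 0 < β := eventually_mem_nhdsWithin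
  have h2 : ∀ᶠ β in 𝓝[>] (0 : ℝ), ‖v i‖ + β < 1 := by
    have hc : Tendsto (fun β : ℝ ↦ ‖v i‖ + β) (𝓝[>] 0) (𝓝 (‖v i‖ + 0)) :=
      (tendsto_const_nhds.add tendsto_id).mono_left nhdsWithin_le_nhds
    exact hc.eventually (gt_mem_nhds (by simpa using hvi))
  have h3 : ∀ᶠ β in 𝓝[>] (0 : ℝ), ∀ j, j ≠ i → 2 * β < ‖v i - v j‖ := by
    refine Filter.eventually_all.2 fun j ↦ ?_
    by_cases hj : j = i
    · exact Filter.Eventually.of_forall fun β h ↦ (h hj).elim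
    · have hpos : 0 < ‖v i - v j‖ := norm_pos_iff.2 (sub_ne_zero.2 (hne j hj))
      have hc : Tendsto (fun β : ℝ ↦ 2 * β) (𝓝[>] 0) (𝓝 (2 * 0)) :=
        (tendsto_id.const_mul 2).mono_left nhdsWithin_le_nhds
      exact (hc.eventually (gt_mem_nhds (by simpa using hpos))).mono fun β h _ ↦ h
  obtain ⟨β, hβ, hvβ, hsep⟩ := (h1.and (h2.and h3)).exists
  exact ⟨β, hβ, hvβ, hsep⟩

/-- The kinematic package used by the composition: for chart 4-velocities `eᵢ = Λᵢ e₀` with `0 < eᵢ⁰` and `e`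
injective, every hole `i` has an admissible receding speed. -/
theorem exists_admissible_speed_of_fourVelocities {N : ℕ} (Λ : Fin N → lorentzGroup)
    (he0 : ∀ i, 0 < (Λ i : E4 ≃L[ℝ] E4) (E4.basisVector 0) 0)
    (hinj : Function.Injective fun i ↦ (Λ i : E4 ≃L[ℝ] E4) (E4.basisVector 0)) (i : Fin N) :
    ∃ β : ℝ, 0 < β ∧
      ‖((Λ i : E4 ≃L[ℝ] E4) (E4.basisVector 0) 0)⁻¹ • E4.spatial ((Λ i : E4 ≃L[ℝ] E4) (E4.basisVector 0))‖ + β < 1 ∧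
      ∀ j, j ≠ i → 2 * β <
        ‖((Λ i : E4 ≃L[ℝ] E4) (E4.basisVector 0) 0)⁻¹ • E4.spatial ((Λ i : E4 ≃L[ℝ] E4) (E4.basisVector 0)) -
          ((Λ j : E4 ≃L[ℝ] E4) (E4.basisVector 0) 0)⁻¹ • E4.spatial ((Λ j : E4 ≃L[ℝ] E4) (E4.basisVector 0))‖ := by
  refine exists_admissible_speed
    (fun j ↦ ((Λ j : E4 ≃L[ℝ] E4) (E4.basisVector 0) 0)⁻¹ • E4.spatial ((Λ j : E4 ≃L[ℝ] E4) (E4.basisVector 0)))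
    i (speed_lt_one (bilin_fourVelocity (Λ i)) (he0 i)) fun j hj hv ↦ hj ?_
  exact (hinj (eq_of_velocity_eq (bilin_fourVelocity (Λ i)) (bilin_fourVelocity (Λ j)) (he0 i) (he0 j) hv)).symm

/-- CLOCK INVERSION: if `E → l` and `E(t) − γ·M((t − c)/γ) → 0` with `γ > 0`, then `M → l/γ` (the hole clock
`t ↦ (t − c)/γ` is an increasing affine bijection of `ℝ`). -/
theorem tendsto_of_clock {M E : ℝ → ℝ} {γ c l : ℝ} (hγ : 0 < γ) (hE : Tendsto E atTop (𝓝 l))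
    (hD : Tendsto (fun t ↦ E t - γ * M ((t - c) / γ)) atTop (𝓝 0)) :
    Tendsto M atTop (𝓝 (l / γ)) := by
  have h1 : Tendsto (fun t ↦ γ * M ((t - c) / γ)) atTop (𝓝 l) := by
    have h := hE.sub hD
    simp only [sub_sub_cancel, sub_zero] at h
    exact h
  have h2 : Tendsto (fun t ↦ M ((t - c) / γ)) atTop (𝓝 (l / γ)) := by
    have h := h1.const_mul γ⁻¹
    simp only [← mul_assoc, inv_mul_cancel₀ hγ.ne', one_mul] at h
    simpa [div_eq_inv_mul] using h
  have h3 : Tendsto (fun s : ℝ ↦ γ * s + c) atTop atTop :=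
    tendsto_atTop_add_const_right _ _ (Tendsto.const_mul_atTop hγ tendsto_id)
  refine (h2.comp h3).congr fun s ↦ ?_
  simp only [Function.comp_apply]
  rw [add_sub_cancel_right, mul_div_cancel_left₀ _ hγ.ne']

/-! ## Composition: the crux BY NAME from the three stubs (real proof, no `sorry`) -/

/-- **M from K1, K2 and RG**: regauge the flat chart (RG); for each hole pick an admissible speed (kinematics);
K1 + `AlmostMonotoneLimit` (landed) give the limit of the receding-sphere energy; K2 identifies it with the boosted
mass label on the hole clock; invert the clock. -/
theorem MassFreezing_of :
    RecedingEnergyAlmostMonotone → RecedingEnergyIdentification → Sig.stub_waveRegauging → MassFreezing := by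
  intro hK1 hK2 hRG X _ _ _ _ _ _ D hD 𝒟 hmax hscri N m₀ χ τ₀ δ₀ M a motion U Ψ ρ U₀ Ψ₀ O hQ i
  -- (1) regauge the flat chart: new flat data satisfying `Q′ ∧ W`
  obtain ⟨τ₁, ρ₁, U₁, Ψ₁, O₁, hQ₁, hW₁⟩ :=
    hRG X D hD 𝒟 hmax hscri N m₀ χ δ₀ M a motion U Ψ ⟨τ₀, ρ, U₀, Ψ₀, O, hQ⟩
  -- (2) kinematics from `Q′`: `0 < eᵢ⁰` (clause 3) and `e` injective (clause 4) ⇒ an admissible speed for hole `i`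
  obtain ⟨-, -, he0, heinj, -⟩ := id hQ₁
  obtain ⟨β, hβ, hvβ, hsep⟩ :=
    exists_admissible_speed_of_fourVelocities (fun j ↦ (motion j).1) he0 heinj i
  -- (3) K1: the receding-sphere energy is almost monotone and bounded below; it converges (AlmostMonotoneLimit)
  obtain ⟨F, T, b, hF, hb, hmono⟩ :=
    hK1 X D hD 𝒟 hmax hscri N m₀ χ τ₁ δ₀ M a motion U Ψ ρ₁ U₁ Ψ₁ O₁ hQ₁ hW₁ i β hβ hvβ hsep
  obtain ⟨l, hl⟩ :=
    Summit.FinalStateConjecture.FinalStateConjecture.Theorems.almostMonotoneLimit_proof _ F T b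
      (fun t ht ↦ hb t ht) (fun t₁ t₂ h₁ h₂ ↦ hmono t₁ h₁ t₂ h₂) hF
  -- (4) K2: the energy is the boosted mass label on the hole clock; invert the clock
  have hid := hK2 X D hD 𝒟 hmax hscri N m₀ χ τ₁ δ₀ M a motion U Ψ ρ₁ U₁ Ψ₁ O₁ hQ₁ hW₁ i β hβ hvβ hsep
  exact ⟨_, tendsto_of_clock (he0 i) hl hid⟩

/-- The crux by name, closed modulo the three registered stubs. -/
theorem massFreezing_of_stubs : MassFreezing :=
  MassFreezing_of stub_recedingEnergyAlmostMonotone stub_recedingEnergyIdentification stub_waveRegauging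

end Summit.FinalStateConjecture.FinalStateConjecture.Cruxes.MassFreezing.Birth

end
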